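import Literature.MathematicalPhysics.QuantumFieldTheory.Balaban1983to89.B8LeafModelZdOfHFP
import Literature.MathematicalPhysics.QuantumFieldTheory.Balaban1983to89.B8SectGH

/-!
# `Balaban1983to89.B8LeafModelZd3` — [Balaban1985RegularSpaces] THE GENERAL-BACKGROUND `ℤᵈ × 𝔸` FAMILY AS THE FULL LEAF CARRIER
# `B8SectGH.GFData3` (the type of the N05 family of record `X.fam8R`), with the (1.36)/(1.37)/(1.39)/(1.140) members read through the
# CANONICAL MASKED LOGARITHM, and TWO abstract-leaf instances on it: THEOREM 4 (p. 88) `B8.Thm4Printed` and PROPOSITION 3 (p. 87)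
# `B8.Prop3Printed` — each modulo NAMED SOCKETS (Proposition 5; [4] Theorem 3.3 = in-edge b9)

statement-level skeleton of published theorems with citation tags; proofs where landed; nothing here is a claim about the
Yang–Mills mass gap

PDF held: `paper:balaban1985-cmp99-regular-spaces-gauge-fixing` (journal page = PDF page + 74); pp. 82–83, 86–89, 94–95, 100–101.

WHY THIS FILE (cell `pub-ymgap`, seat `pub-ymgap-dag-n05-a` g5, KNIT seat of DAG node N05 = [B8]; a PROTOTYPE of NODE 00's Stage 3′
member «X.B8» — node00-def may rename/re-home; count-neutral).  The re-typed leaf `B8LeafKnitRS.B8LeafRS` reads five of its nine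
conjuncts (`t2 p3 t4 p7 t8`) on ONE family `fam : I₂ → B8SectGH.GFData3`.  `B8LeafModelZd.zdGF` (g4) is only a `B8.GFData` and
models the (1.36)/(1.39) members NOT AT ALL («serves t4 only»); worse, a (1.36)-gradient member reading `(1/iη) log U₁` at EVERY
bond would read the logarithm of an arbitrary unitary off `⋃_j Ω_j` (hazard №3′).  This file fixes the member once and for all:
every exponent-reading field goes through **`mlogCfg k η Ω U₁`** = `(1/iη) log U₁` on the sides of the plaquettes touching some
`Ω_j`, `j ≤ k`, and `0` elsewhere (the field `exists_maskedLogField` produces, made canonical), so that (1.36) `C136` = «`U₁ = e^{iηA}`,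
`A` Hermitian, `|A| ≤ B₁s(Lʲη)⁻¹` on the `E j`» ∧ `|∇^η_{U₀}A|₍₋₂₎ ≤ B₁s` ∧ `‖A‖_{1,β}-sup ≤ B₂s`, (1.37) `C137` = «`|Q_j(U₀, ηA)| < 2dLα₁`
on the constraint bonds», (1.39) `C139` = `|D^{η*}D^ηA|₍₋₃₎ ≤ B₁s ∧ |Δ^η_{U₀}A|₍₋₃₎ ≤ B₁s`, (1.140) `C140` (three members, pointwise) ALL
read `A := mlogCfg`.  The k-level norms are r05's `B8ScaledSupNorm.msup` / `bondNorm` exactly as in n05-b's `B8Prop3KLevel` and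
n11-b's `B8Thm2GaugeFixedKLevel` (`|A|₍₋₁₎`, `|∇A|₍₋₂₎` over `SideTouches (Ω j)`; `|D*DA|₍₋₃₎ = bondNorm (−3) (pdiv ∘ plaqCovDeriv A)`;
`|ΔA|₍₋₃₎ = bondNorm (−3)` of the componentwise covariant Laplacian `B8Eq138LandauZd.covLap`; the Hölder member = the weighted
supremum of [4] (3.40)'s quotients of the covariant gradient, `B9Eq340HolderZd.hquot`, over the admissible pairs starting in `Ω_j` —
n05-b's reading `B8Prop3KLevel.prop3_pointwise_holder_kLevel`).  Theorem-8 fields: `InR := InR138`, `LandauF := IsLandau146W` (g4),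
`fNorm f := |f|₍₋₂₎`, `fGrad U₀ f := |D^η_{U₀}f|₍₋₃₎` (forward covariant differences).

WHAT IS PROVED (kernel, 0 sorry): §1 `mlogCfg` API (`mlogCfg_of_sideTouches`, `mlogCfg_of_not`, `mlogCfg_spec` = the three clauses of
`exists_maskedLogField` for the canonical field); §3 **`thm4Printed_zd3 : B8.Thm4Printed (5dLB₀) (fun i => (zdGF3 𝔸 L β len i).toGFData)`**
— the g4 assembly `B8Thm4Concrete.thm4Body_concrete_uniform` re-run with (1.37) for the canonical exponent, modulo the g4 sockets
`SockP5base`/`SockP5`/`SockH59`/`SockP5u`, and **`thm4Printed_zd3_of_HFP`** / `_of_HFP₄` with the first two in plain fixed-point currency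
(`B8LeafModelZdOfHFP.SockHFP₀`/`SockHFP`, by its socket adapters); §4 the Prop.-3-frame b9 socket **`SockB9P3`** ([4] Thm 3.3 for `G(U₀)`, `H(U₀)`: the five (1.59) lines for a masked
Hermitian `A′` in the Landau gauge of record, guarded by (1.40) and the (1.41)-smallness) and **`prop3Printed_zd3 : B8.Prop3Printed d L C₂
inp B₀β (fun i => (zdGF3 𝔸 L β len i).toGFData2)`** for every `C₂ ≥ 2097152(d+1)²` and `B₀β ≥ 0` — n05-b's `prop3_norms_kLevel` +
`prop3_fifth_kLevel` (Prop. 3 at `k` levels, pp. 86–87) at `A := mlogCfg U₁`, windows from ONE threshold `c(d, L, B₀, cP)`.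

HONEST SCOPE / DECLARED READINGS.  (i) As in `zdGF`: `Pert` carries its background, `GT` is carried by `Ω₀`, `Reg335 := True` ((3.35)
of [4] is DROPPED by print via Prop. 6, p. 83 «eventually we will drop it»/p. 98; consequently `SockB9P3` is guarded by (1.40) only and
its provider composes [4] Thm 3.3 with Prop. 6 = leaf conjunct `p6`).  (ii) Norm form `≤ B·s` of the k-level weighted suprema for
print's pointwise `<` «on Ω_j» ((1.36)₂,₃, (1.39)); pointwise for (1.36)₁/(1.62)/(1.140); `E j = SideTouches (Ω j)` (G-B8-16).  (iii)
The Hölder exponent `β` (print's β₀) and the length function `len` of [4] (3.40) are FAMILY PARAMETERS.  (iv) `Δ^η_{U₀}` on vector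
fields read componentwise as `Σ_ν D_ν^*D_ν` (`covLap`); print's (1.39) lists `|D*DA|` and `|ΔA|` separately — both members carried.
(v) Nothing of Propositions 3/5, (1.42), (1.59) is re-proved (by name / sockets).  Count-neutral; N05 NOT discharged; nothing
continuum / ℝ⁴ / OS / mass-gap / Clay.  Unit `pub-ymgap-dag-n05-a` (g5), 2026-08-26.
-/

noncomputable section

open NormedSpace

namespace Literature.MathematicalPhysics.QuantumFieldTheory.Balaban1983to89.B8LeafModelZd3

open Complex (I)
open MatrixLog B7Prop1Explicit B7Prop2Explicit B7Prop1Local B7Eq92Concrete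
open B7Prop2Explicit (C0 c2')
open B7Prop3Flat (c3)
open B8Ineq132 (covDerivFwd InAk BondTouches)
open B8Eq119TwistedAxial (Restr129 InAx)
open B8Eq184Proof (gaugeExp cfgExp)
open B8Lemma1NonAbelian (mulCfg)
open B8Eq140Level (SideTouches)
open B8Eq146AExpansion (iEta expCfg plaqCovDeriv)
open B8Eq143PlaqExpansion (pdiv)
open B7Prop4GeneralLevels (logCovIter linCovIter)
open B8Eq155JBound (Jcur wsup)
open B8ScaledSupNorm (bondNorm msup weight Bdd)
open B8Thm2LogB (blockTop)
open B8Ineq130 (tlo thi)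
open B8Eq138LandauZd (IsLandau138W IsLandau146W InR138 logCfg covLap)
open B8Prop3GaugeFixedKLevel (mem_unitaryUnits_of_mgauge_eq logField_spec inAk_congr_of_sideTouches expCfg_iEta_eq_cfgExp
  cfgExp_congr_at)
open B8Thm4AtLandau138 (mgauge_mgauge_inv)
open B8Thm4Concrete (thm4Body_concrete_uniform)
open B8Thm4Windows (thm4_windows thm4_windows_extra)
open B8LeafModelZd (SockP5base SockP5 SockH59 SockP5u ZdIdx)
open B8LeafModelZdOfHFP (SockHFP₀ SockHFP windows4 sockP5base_of_sockHFP₀ sockP5_of_sockHFP sockH59_anti sockP5u_anti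
  sockHFP₀_anti sockHFP_anti)
open B9Eq340HolderZd (hquot AdmPair)

-- `Site` alone could resolve to the torus sites of `Setup.lean`; re-export the `ℤ^d` sites of `B7Prop1Explicit`.
export B7Prop1Explicit (Site)

variable {d : ℕ}

/-! ## §1 The canonical masked logarithm `mlogCfg` -/

section MaskedLog

variable {𝔸 : Type*} [CStarAlgebra 𝔸]

open Classical in
/-- **The canonical exponent field of a configuration near `1` on the region sequence**: `A(b) = (1/iη) log U₁(b)` (principal logarithm,
`B8Eq138LandauZd.logCfg`) if the bond `b` is a side of a plaquette touching some `Ω_j`, `j ≤ k`, and `A(b) = 0` otherwise — the field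
`B8Thm2GaugeFixedKLevel.exists_maskedLogField` produces, made canonical. [cite: Balaban1985RegularSpaces, (1.36) p.82 («U₁ = exp iηA»), p.89 («A₀ = (1/iη) log U′»), p.77 (bond convention)] -/
def mlogCfg (k : ℕ) (η : ℝ) (Ω : ℕ → Set (Site d)) (U₁ : Site d → Fin d → 𝔸ˣ) : Site d → Fin d → 𝔸 :=
  fun y τ => if ∃ j, j ≤ k ∧ SideTouches (Ω j) y τ then logCfg η U₁ y τ else 0

/-- On a side of a plaquette touching `Ω_j`, `j ≤ k`, the masked logarithm is the logarithm. [cite: Balaban1985RegularSpaces, (1.36) p.82] -/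
theorem mlogCfg_of_sideTouches {k : ℕ} (η : ℝ) {Ω : ℕ → Set (Site d)} (U₁ : Site d → Fin d → 𝔸ˣ) {j : ℕ} (hj : j ≤ k)
    {y : Site d} {τ : Fin d} (h : SideTouches (Ω j) y τ) : mlogCfg k η Ω U₁ y τ = logCfg η U₁ y τ := by
  classical
  exact if_pos ⟨j, hj, h⟩

/-- Off the sides of the plaquettes touching the `Ω_j`, `j ≤ k`, the masked logarithm vanishes. [cite: Balaban1985RegularSpaces, p.77 (bond convention)] -/
theorem mlogCfg_of_not {k : ℕ} (η : ℝ) {Ω : ℕ → Set (Site d)} (U₁ : Site d → Fin d → 𝔸ˣ) {y : Site d} {τ : Fin d}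
    (h : ∀ j, j ≤ k → ¬ SideTouches (Ω j) y τ) : mlogCfg k η Ω U₁ y τ = 0 := by
  classical
  exact if_neg fun ⟨j, hj, hs⟩ => h j hj hs

/-- **The three clauses of `exists_maskedLogField` for the CANONICAL field**: if `W` is unitary-valued with `W_b = e^{iηA_b}`,
`‖A_b‖ ≤ c⋆(Lʲη)⁻¹` on the sides of the plaquettes touching `Ω_j` (`j ≤ k`), `16c⋆ ≤ 1`, `L ≥ 1`, then `mlogCfg k η Ω W` is
self-adjoint everywhere, equals `A` there with `W = e^{iη·mlogCfg}`, and vanishes elsewhere (`logField_spec`: the principal logarithm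
of a unitary near `1`). [cite: Balaban1985RegularSpaces, (1.36) p.82, p.89 («A₀ = (1/iη) log U′»)] -/
theorem mlogCfg_spec {η : ℝ} (hη : 0 < η) {L : ℕ} (hL : 1 ≤ L) (k : ℕ) (U₀ : Site d → Fin d → 𝔸ˣ)
    {W : Site d → Fin d → 𝔸ˣ} (hWu : ∀ x κ, W x κ ∈ unitaryUnits 𝔸) {A : Site d → Fin d → 𝔸} {cstar : ℝ}
    (hc0 : 0 ≤ cstar) (hc16 : 16 * cstar ≤ 1) (Ω : ℕ → Set (Site d))
    (hWA : ∀ j, j ≤ k → ∀ y τ, SideTouches (Ω j) y τ → W y τ = cfgExp η A y τ ∧ ‖A y τ‖ ≤ cstar * ((L : ℝ) ^ j * η)⁻¹) :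
    (∀ y τ, IsSelfAdjoint (mlogCfg k η Ω W y τ)) ∧
      (∀ j, j ≤ k → ∀ y τ, SideTouches (Ω j) y τ → mlogCfg k η Ω W y τ = A y τ ∧ W y τ = cfgExp η (mlogCfg k η Ω W) y τ) ∧
      (∀ y τ, (∀ j, j ≤ k → ¬ SideTouches (Ω j) y τ) → mlogCfg k η Ω W y τ = 0) := by
  have hLr : (1 : ℝ) ≤ L := by exact_mod_cast hL
  have hc16' : cstar ≤ 1 / 16 := by linarith
  have hsock : ∀ j, j ≤ k → ∀ y τ, SideTouches (Ω j) y τ →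
      mlogCfg k η Ω W y τ = A y τ ∧ IsSelfAdjoint (mlogCfg k η Ω W y τ) ∧ W y τ = cfgExp η (mlogCfg k η Ω W) y τ := by
    intro j hj y τ hs
    obtain ⟨hWA₁, hA₁⟩ := hWA j hj y τ hs
    have hLj : (1 : ℝ) ≤ (L : ℝ) ^ j := one_le_pow₀ hLr
    have hA₂ : ‖A y τ‖ ≤ cstar * η⁻¹ := by
      calc ‖A y τ‖ ≤ cstar * ((L : ℝ) ^ j * η)⁻¹ := hA₁
        _ = cstar * η⁻¹ * ((L : ℝ) ^ j)⁻¹ := by rw [mul_inv]; ring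
        _ ≤ cstar * η⁻¹ * 1 := by
            apply mul_le_mul_of_nonneg_left (inv_le_one_of_one_le₀ hLj) (by positivity)
        _ = cstar * η⁻¹ := mul_one _
    obtain ⟨hlog, hsa, hexp⟩ := logField_spec hη U₀ hWu hWA₁ hA₂ hc16'
    have hmy : mlogCfg k η Ω W y τ = logCfg η W y τ := mlogCfg_of_sideTouches η W hj hs
    have hlog' : logCfg η W y τ = η⁻¹ • ((I⁻¹ : ℂ) • mlog ((W y τ : 𝔸ˣ) : 𝔸)) := rfl
    refine ⟨by rw [hmy, hlog', hlog], by rw [hmy, hlog']; exact hsa, ?_⟩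
    rw [hexp]
    exact cfgExp_congr_at η (by rw [hmy, hlog'])
  refine ⟨?_, fun j hj y τ hs => ⟨(hsock j hj y τ hs).1, (hsock j hj y τ hs).2.2⟩, fun y τ h => mlogCfg_of_not η W h⟩
  intro y τ
  by_cases hmem : ∃ j, j ≤ k ∧ SideTouches (Ω j) y τ
  · obtain ⟨j, hj, hs⟩ := hmem
    exact (hsock j hj y τ hs).2.1
  · rw [mlogCfg_of_not η W fun j hj hs => hmem ⟨j, hj, hs⟩]
    exact IsSelfAdjoint.zero 𝔸

end MaskedLog

/-! ## §2 The member: the general-background `ℤᵈ × 𝔸` family as `B8SectGH.GFData3` -/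

section Family

variable (𝔸 : Type) [CStarAlgebra 𝔸] [Nontrivial 𝔸] (L : ℕ) (β : ℝ) (len : Site d → ℝ)

/-- **The general-background `ℤᵈ × 𝔸` member as the full leaf carrier `B8SectGH.GFData3`** over the g4 index `B8LeafModelZd.ZdIdx`
(geometry: `η, k, {Ω_j}, Λs, Λb` with `hbox`/`hclass`/`htower`/`hpart`), Hölder exponent `β` and length function `len` of [4] (3.40) as
family parameters.  The `B8.GFData` part agrees with `B8LeafModelZd.zdGF` in every field Theorem 4 reads except (1.37) `C137`, now read
on the canonical exponent `mlogCfg`; (1.36) `C136`, (1.39) `C139`, (1.40)₂ `InAPair`, `fGrad`, (1.140) `C140`, `InR`, `fNorm` get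
honest bodies (module docstring). [cite: Balaban1985RegularSpaces, (1.29) p.81, (1.33)–(1.39) p.82, (1.40) p.83, (1.62) p.87, (1.66) p.88, (1.140) p.100, (1.146) p.101] -/
def zdGF3 (i : ZdIdx d L) : B8SectGH.GFData3 where
  Cfg := {U : Site d → Fin d → 𝔸ˣ // ∀ x κ, U x κ ∈ unitaryUnits 𝔸}
  Pert := {U : Site d → Fin d → 𝔸ˣ // ∀ x κ, U x κ ∈ unitaryUnits 𝔸} × {U : Site d → Fin d → 𝔸ˣ // ∀ x κ, U x κ ∈ unitaryUnits 𝔸}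
  GT := {u : Site d → 𝔸ˣ // (∀ x, u x ∈ unitaryUnits 𝔸) ∧ ∀ x, x ∉ i.Ω 0 → u x = 1}
  Src := Site d → 𝔸
  k := i.k
  InA := fun α U₀ => InAk L i.k i.η α i.Ω U₀.1
  Reg335 := fun _ _ => True
  InAAx := fun α U₀ P => P.1 = U₀ ∧ InAk L i.k i.η α i.Ω (mulCfg P.2.1 U₀.1) ∧ ∀ m, m ≤ i.k → InAx L m (i.Λs m) U₀.1 (mulCfg P.2.1 U₀.1)
  avgClose := fun α U₀ P => ∀ j, j ≤ i.k → ∀ (z : Site d) (μ : Fin d), (∀ x, InBox (loK L j z) (bondHiK L j z μ) x → x ∈ i.Ω j) →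
    ‖(avgIter L (mulCfg P.2.1 U₀.1) j z μ : 𝔸) - (avgIter L U₀.1 j z μ : 𝔸)‖ ≤ α
  avgClose166 := fun α U₀ P => (∀ j, j ≤ i.k → ∀ (z : Site d) (μ : Fin d), (∀ x, InBox (loK L j z) (bondHiK L j z μ) x → x ∈ i.Ω j) →
      ‖(avgIter L (mulCfg P.2.1 U₀.1) j z μ : 𝔸) - (avgIter L U₀.1 j z μ : 𝔸)‖ ≤ α) ∧
    ∀ b ∈ {b : Site d × Fin d | SideTouches (i.Ω 0) b.1 b.2}, ‖((P.2.1 b.1 b.2 : 𝔸ˣ) : 𝔸) - 1‖ ≤ α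
  Restricted := fun U₀ u => Restr129 L i.k (i.Λs i.k) U₀.1 u.1
  act := fun P u => (P.1, ⟨mgauge P.1.1 u.1⁻¹ P.2.1,
    fun x κ => mem_unitaryUnits_of_mgauge_eq P.1.2 P.2.2 u.2.1 (mgauge_mgauge_inv P.1.1 P.2.1 u.1) x κ⟩)
  C136 := fun B₁ B₂ s U₀ P =>
    (∀ j, j ≤ i.k → ∀ b ∈ {b : Site d × Fin d | SideTouches (i.Ω j) b.1 b.2},
      P.2.1 b.1 b.2 = cfgExp i.η (logCfg i.η P.2.1) b.1 b.2 ∧ IsSelfAdjoint (logCfg i.η P.2.1 b.1 b.2) ∧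
        ‖logCfg i.η P.2.1 b.1 b.2‖ ≤ B₁ * s * ((L : ℝ) ^ j * i.η)⁻¹) ∧
    msup L i.k i.η (-(2 : ℝ)) (fun j (t : Fin d × Fin d × Site d) => SideTouches (i.Ω j) t.2.2 t.2.1)
        (fun t => covDerivFwd i.η U₀.1 t.1 (fun z => mlogCfg i.k i.η i.Ω P.2.1 z t.2.1) t.2.2) ≤ B₁ * s ∧
    msup L i.k i.η (-(2 + β)) (fun j (q : Fin d × Fin d × (Site d × Site d)) => q.2.2 ∈ AdmPair i.η len ∧ q.2.2.1 ∈ i.Ω j)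
        (fun q => hquot i.η β len U₀.1 (covDerivFwd i.η U₀.1 q.1 (fun z => mlogCfg i.k i.η i.Ω P.2.1 z q.2.1)) q.2.2) ≤ B₂ * s
  C137 := fun α₁ U₀ P => ∀ j, j ≤ i.k → ∀ c ∈ i.Λb i.k j,
    ‖logCovIter L U₀.1 (iEta i.η (mlogCfg i.k i.η i.Ω P.2.1)) j c.1 c.2‖ < 2 * d * L * α₁
  Landau := fun U₀ P => IsLandau138W L i.k i.η (i.Ω 0) (i.Λs i.k) U₀.1 P.2.1
  C139 := fun B s U₀ P =>
    bondNorm L i.k i.η (-(3 : ℝ)) i.Ω (fun x μ => pdiv i.η U₀.1 (plaqCovDeriv i.η U₀.1 (mlogCfg i.k i.η i.Ω P.2.1)) μ x) ≤ B * s ∧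
    bondNorm L i.k i.η (-(3 : ℝ)) i.Ω (fun x μ => covLap i.η U₀.1 (fun z => mlogCfg i.k i.η i.Ω P.2.1 z μ) x) ≤ B * s
  C162 := fun B s _ P => ∀ j, j ≤ i.k → ∀ b ∈ {b : Site d × Fin d | SideTouches (i.Ω j) b.1 b.2},
    P.2.1 b.1 b.2 = cfgExp i.η (logCfg i.η P.2.1) b.1 b.2 ∧ IsSelfAdjoint (logCfg i.η P.2.1 b.1 b.2) ∧
      ‖logCfg i.η P.2.1 b.1 b.2‖ ≤ B * s * ((L : ℝ) ^ j * i.η)⁻¹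
  fNorm := fun f => msup L i.k i.η (-(2 : ℝ)) (fun j (x : Site d) => x ∈ i.Ω j) f
  LandauF := fun U₀ f P => IsLandau146W L i.k i.η (i.Ω 0) (i.Λs i.k) U₀.1 f P.2.1
  InAPair := fun α U₀ P => InAk L i.k i.η α i.Ω (mulCfg P.2.1 U₀.1)
  fGrad := fun U₀ f => msup L i.k i.η (-(3 : ℝ)) (fun j (p : Fin d × Site d) => p.2 ∈ i.Ω j) (fun p => covDerivFwd i.η U₀.1 p.1 f p.2)
  C140 := fun α₂ U₀ P => ∀ j, j ≤ i.k → ∀ (y : Site d) (τ : Fin d), SideTouches (i.Ω j) y τ →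
    P.2.1 y τ = cfgExp i.η (mlogCfg i.k i.η i.Ω P.2.1) y τ ∧ IsSelfAdjoint (mlogCfg i.k i.η i.Ω P.2.1 y τ) ∧
      ((L : ℝ) ^ j * i.η) * ‖mlogCfg i.k i.η i.Ω P.2.1 y τ‖ < α₂ ∧
      (∀ κ : Fin d, ((L : ℝ) ^ j * i.η) ^ 2 * ‖covDerivFwd i.η U₀.1 κ (fun z => mlogCfg i.k i.η i.Ω P.2.1 z τ) y‖ < α₂) ∧
      ((L : ℝ) ^ j * i.η) ^ 3 * ‖pdiv i.η U₀.1 (plaqCovDeriv i.η U₀.1 (mlogCfg i.k i.η i.Ω P.2.1)) τ y‖ < α₂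
  InR := fun U₀ f => InR138 L i.k i.η (i.Ω 0) (i.Λs i.k) U₀.1 f

end Family

/-! ## §3 THEOREM 4 (p. 88) as `B8.Thm4Printed` on `zdGF3`, modulo the g4 sockets -/

section Thm4

variable {𝔸 : Type} [CStarAlgebra 𝔸] [Nontrivial 𝔸]

/-- **`B8.Thm4Printed (5dLB₀)` ON `zdGF3`** (Theorem 4, p. 88), for `d, L ≥ 2`, `B₀ > 0` with `2 ≤ 5dLB₀`, `B₀′ > 0`, `cu, cP > 0`, any
Hölder data `β, len` (not read by Theorem 4) — MODULO the g4 sockets `SockP5base` / `SockP5` / `SockP5u` (Prop. 5) and `SockH59` ([4] Thm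
3.3, in-edge b9) per member.  The g4 assembly `B8Thm4Concrete.thm4Body_concrete_uniform` with (1.37) `C137` established for the
CANONICAL exponent `mlogCfg` of the gauge-fixed field (`mlogCfg_spec` + the (1.42) lemma `B8Eq142KLevelLocal.H42_of_inAx`); windows by
`B8Thm4Windows`. [cite: Balaban1985RegularSpaces, Thm 4 p.88, (1.29) p.81, (1.37)–(1.38) p.82, (1.62) p.87, Prop. 5 p.94, pp.94–95] -/
theorem thm4Printed_zd3 (hd2 : 2 ≤ d) {L : ℕ} (hL : 2 ≤ L) {β : ℝ} {len : Site d → ℝ} {B₀ B₀' cu cP : ℝ} (hB₀ : 0 < B₀)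
    (hB₀' : 0 < B₀') (hB : 2 ≤ 5 * (d : ℝ) * L * B₀) (hcu : 0 < cu) (hcP : 0 < cP)
    (SP5base : ∀ i : ZdIdx d L, SockP5base (𝔸 := 𝔸) L B₀ B₀' cP i.η i.k i.Ω i.Λs)
    (SP5 : ∀ i : ZdIdx d L, SockP5 (𝔸 := 𝔸) L B₀ B₀' cP i.η i.k i.Ω i.Λs)
    (SH59 : ∀ i : ZdIdx d L, SockH59 (𝔸 := 𝔸) L B₀ B₀' cP i.η i.k i.Ω i.Λs i.Λb)
    (SP5u : ∀ i : ZdIdx d L, SockP5u (𝔸 := 𝔸) L cP cu i.η i.k i.Ω i.Λs) :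
    B8.Thm4Printed (5 * (d : ℝ) * L * B₀) (fun i : ZdIdx d L => (zdGF3 𝔸 L β len i).toGFData) := by
  have hL1 : 1 ≤ L := le_trans (by norm_num) hL
  have hd1 : 1 ≤ d := le_trans (by norm_num) hd2
  have hL' : (1 : ℝ) ≤ L := by exact_mod_cast hL1
  obtain ⟨c₁, hc₁, H⟩ := thm4Body_concrete_uniform (𝔸 := 𝔸) hd2 hL hB₀ hB₀' hB hcu hcP
  obtain ⟨cw, hcw, hw⟩ := thm4_windows hd1 hL1 hB₀ hB₀' hB
  obtain ⟨cw', hcw', hw'⟩ := thm4_windows_extra (d := d) hL1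
  refine ⟨min c₁ (min cw cw'), lt_min hc₁ (lt_min hcw hcw'), ?_⟩
  intro i α₀ α₁ hα₀ hα₁ hs U₀ P hInA _ hInAAx h166
  have hs₁ : α₀ + α₁ ≤ c₁ := hs.trans (min_le_left _ _)
  have hsw : α₀ + α₁ ≤ cw := hs.trans ((min_le_right _ _).trans (min_le_left _ _))
  have hsw' : α₀ + α₁ ≤ cw' := hs.trans ((min_le_right _ _).trans (min_le_right _ _))
  obtain ⟨hP1, h34, hAx⟩ := hInAAx
  obtain ⟨h135, h66⟩ := h166
  subst hP1
  obtain ⟨u, hu, huS, h129, hLan, hleaf, huniq⟩ := H i.η i.hη i.k i.Ω i.hΩ i.Λs i.Λb i.hbox i.hclass i.htower i.hpart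
    (SP5base i) (SP5 i) (SH59 i) (SP5u i) α₀ α₁ hα₀ hα₁ hs₁ P.1.1 P.2.1 P.1.2 P.2.2 hInA h34 hAx h135 h66
  -- windows for the (1.42) lemma
  obtain ⟨-, -, -, -, w5, w6, w7, -, w9, w10, -, -, -, -, -, -, -, -⟩ :=
    hw α₀ α₁ hα₀ hα₁ hsw (5 * (d : ℝ) * L * B₀ * (α₀ + α₁)) (8 * B₀' * (5 * (d : ℝ) * L * B₀) * (α₀ + α₁)) rfl rfl
  obtain ⟨w19, -⟩ := hw' α₀ α₁ hα₀ hα₁ hsw'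
  have hcs0 : 0 ≤ 5 * (d : ℝ) * L * B₀ * (α₀ + α₁) := by positivity
  have hKS0 : 0 ≤ 2 * (L * (5 * (d : ℝ) * L * B₀ * (α₀ + α₁))) + 8 * (8 * B₀' * (5 * (d : ℝ) * L * B₀) * (α₀ + α₁)) := by
    positivity
  have hcK : 5 * (d : ℝ) * L * B₀ * (α₀ + α₁) ≤
      2 * (L * (5 * (d : ℝ) * L * B₀ * (α₀ + α₁))) + 8 * (8 * B₀' * (5 * (d : ℝ) * L * B₀) * (α₀ + α₁)) := by
    have h₁ : (1 : ℝ) * (5 * (d : ℝ) * L * B₀ * (α₀ + α₁)) ≤ L * (5 * (d : ℝ) * L * B₀ * (α₀ + α₁)) :=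
      mul_le_mul_of_nonneg_right hL' hcs0
    have h₂ : 0 ≤ 8 * (8 * B₀' * (5 * (d : ℝ) * L * B₀) * (α₀ + α₁)) := by positivity
    linarith
  have hc16 : 16 * (5 * (d : ℝ) * L * B₀ * (α₀ + α₁)) ≤ 1 := by linarith
  -- the gauge-fixed field and its CANONICAL masked exponent
  have hW : mgauge P.1.1 u (mgauge P.1.1 u⁻¹ P.2.1) = P.2.1 := mgauge_mgauge_inv P.1.1 P.2.1 u
  have hWu : ∀ x κ, mgauge P.1.1 u⁻¹ P.2.1 x κ ∈ unitaryUnits 𝔸 := mem_unitaryUnits_of_mgauge_eq P.1.2 P.2.2 hu hW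
  have hWA : ∀ j, j ≤ i.k → ∀ y τ, SideTouches (i.Ω j) y τ →
      mgauge P.1.1 u⁻¹ P.2.1 y τ = cfgExp i.η (logCfg i.η (mgauge P.1.1 u⁻¹ P.2.1)) y τ ∧
        ‖logCfg i.η (mgauge P.1.1 u⁻¹ P.2.1) y τ‖ ≤ (5 * (d : ℝ) * L * B₀ * (α₀ + α₁)) * ((L : ℝ) ^ j * i.η)⁻¹ :=
    fun j hj y τ h => ⟨(hleaf j hj (y, τ) h).1, (hleaf j hj (y, τ) h).2.2⟩
  obtain ⟨hA'sa, hA'eq, hA'zero⟩ := mlogCfg_spec i.hη hL1 i.k P.1.1 hWu hcs0 hc16 i.Ω hWA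
  set A' := mlogCfg i.k i.η i.Ω (mgauge P.1.1 u⁻¹ P.2.1) with hA'_def
  have hA'bd : ∀ j, j ≤ i.k → ∀ y τ, SideTouches (i.Ω j) y τ →
      mgauge P.1.1 u⁻¹ P.2.1 y τ = cfgExp i.η A' y τ ∧
        ‖A' y τ‖ ≤ (2 * (L * (5 * (d : ℝ) * L * B₀ * (α₀ + α₁))) + 8 * (8 * B₀' * (5 * (d : ℝ) * L * B₀) * (α₀ + α₁))) *
          ((L : ℝ) ^ j * i.η)⁻¹ := by
    intro j hj y τ h
    obtain ⟨hAA, hWexp⟩ := hA'eq j hj y τ h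
    refine ⟨hWexp, ?_⟩
    rw [hAA]
    have hη0 : 0 ≤ i.η := i.hη.le
    exact ((hWA j hj y τ h).2).trans (mul_le_mul_of_nonneg_right hcK (by positivity))
  have h137 := B8Eq142KLevelLocal.H42_of_inAx hd2 i.hη hL i.k P.1.2 hα₀ hα₁ hKS0 w5 w6 w7 w9 w10 w19 i.Ω i.hΩ i.Λs i.Λb i.hbox
    i.hclass hInA h34 hAx h135 (fun m W => IsLandau138W L m i.η (i.Ω 0) (i.Λs m) P.1.1 W) i.k i.hk le_rfl u
    (mgauge P.1.1 u⁻¹ P.2.1) A' hu hW h129 (hLan i.hk) hA'sa hA'bd hA'zero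
  refine ⟨⟨u, hu, huS⟩, h129, ⟨h137, hLan i.hk, ?_⟩, ?_⟩
  · intro j hj b hb
    exact hleaf j hj b hb
  · intro u' hR' _ hLan' h162'
    apply Subtype.ext
    refine huniq u'.1 u'.2.1 u'.2.2 hR' hLan' ⟨logCfg i.η (mgauge P.1.1 u'.1⁻¹ P.2.1), fun j hj x κ h => ?_⟩ i.hk
    exact ⟨(h162' j hj (x, κ) h).1, (h162' j hj (x, κ) h).2.2⟩

/-- **The same with the two Proposition-5 EXISTENCE sockets in PLAIN FIXED-POINT CURRENCY** (`B8LeafModelZdOfHFP.SockHFP₀` / `SockHFP`,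
n04-b's `HFP₀`/`HFP` under the guard — the output currency of №41-b's contraction `B8Prop5ContractionKLevel`), by the socket adapters
`sockP5base_of_sockHFP₀` / `sockP5_of_sockHFP` below the common threshold `min cP c₁` (`c₁` of `windows4`), the other two sockets by
antitonicity. [cite: Balaban1985RegularSpaces, Thm 4 p.88, Prop. 5 (1.106)–(1.109) p.94, pp.94–95] -/
theorem thm4Printed_zd3_of_HFP (hd2 : 2 ≤ d) {L : ℕ} (hL : 2 ≤ L) {β : ℝ} {len : Site d → ℝ} {B₀ B₀' cu cP : ℝ} (hB₀ : 0 < B₀)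
    (hB₀' : 0 < B₀') (hB : 2 ≤ 5 * (d : ℝ) * L * B₀) (hcu : 0 < cu) (hcP : 0 < cP)
    (SHFP₀ : ∀ i : ZdIdx d L, SockHFP₀ (𝔸 := 𝔸) L B₀ B₀' cP i.η i.k i.Ω i.Λs)
    (SHFP : ∀ i : ZdIdx d L, SockHFP (𝔸 := 𝔸) L B₀ B₀' cP i.η i.k i.Ω i.Λs)
    (SH59 : ∀ i : ZdIdx d L, SockH59 (𝔸 := 𝔸) L B₀ B₀' cP i.η i.k i.Ω i.Λs i.Λb)
    (SP5u : ∀ i : ZdIdx d L, SockP5u (𝔸 := 𝔸) L cP cu i.η i.k i.Ω i.Λs) :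
    B8.Thm4Printed (5 * (d : ℝ) * L * B₀) (fun i : ZdIdx d L => (zdGF3 𝔸 L β len i).toGFData) := by
  have hL1 : 1 ≤ L := le_trans (by norm_num) hL
  have hd1 : 1 ≤ d := le_trans (by norm_num) hd2
  obtain ⟨c₁, hc₁, hwin⟩ := windows4 hd1 hL1 hB₀ hB₀' hB
  have hm₁ : min cP c₁ ≤ cP := min_le_left _ _
  have hwin' : ∀ α₀ α₁ : ℝ, 0 < α₀ → 0 < α₁ → α₀ + α₁ ≤ min cP c₁ →
      8 * B₀' * (5 * (d : ℝ) * L * B₀) * (α₀ + α₁) ≤ 1 / 84 ∧ L * (5 * (d : ℝ) * L * B₀ * (α₀ + α₁)) ≤ 1 / 12 ∧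
        α₁ ≤ 1 / 4 ∧ 2 * α₁ ≤ 5 * (d : ℝ) * L * B₀ * (α₀ + α₁) :=
    fun α₀ α₁ hα₀ hα₁ hs => hwin α₀ α₁ hα₀ hα₁ (hs.trans (min_le_right _ _))
  exact thm4Printed_zd3 hd2 hL hB₀ hB₀' hB hcu (lt_min hcP hc₁)
    (fun i => sockP5base_of_sockHFP₀ hd2 i.hη hL1 hB₀.le hm₁ hwin' (SHFP₀ i))
    (fun i => sockP5_of_sockHFP hd2 i.hη hL1 hB₀.le hm₁ hwin' (SHFP i))
    (fun i => sockH59_anti hm₁ (SH59 i)) (fun i => sockP5u_anti hm₁ (SP5u i))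

/-- **… and with four INDEPENDENT provider thresholds** (the form the providers deliver in). [cite: Balaban1985RegularSpaces, Thm 4 p.88 («there exists a constant c₁»), Prop. 5 p.94, (1.59) p.86] -/
theorem thm4Printed_zd3_of_HFP₄ (hd2 : 2 ≤ d) {L : ℕ} (hL : 2 ≤ L) {β : ℝ} {len : Site d → ℝ} {B₀ B₀' cu cF₀ cF c59 cu' : ℝ}
    (hB₀ : 0 < B₀) (hB₀' : 0 < B₀') (hB : 2 ≤ 5 * (d : ℝ) * L * B₀) (hcu : 0 < cu) (hcF₀ : 0 < cF₀) (hcF : 0 < cF)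
    (hc59 : 0 < c59) (hcu' : 0 < cu')
    (SHFP₀ : ∀ i : ZdIdx d L, SockHFP₀ (𝔸 := 𝔸) L B₀ B₀' cF₀ i.η i.k i.Ω i.Λs)
    (SHFP : ∀ i : ZdIdx d L, SockHFP (𝔸 := 𝔸) L B₀ B₀' cF i.η i.k i.Ω i.Λs)
    (SH59 : ∀ i : ZdIdx d L, SockH59 (𝔸 := 𝔸) L B₀ B₀' c59 i.η i.k i.Ω i.Λs i.Λb)
    (SP5u : ∀ i : ZdIdx d L, SockP5u (𝔸 := 𝔸) L cu' cu i.η i.k i.Ω i.Λs) :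
    B8.Thm4Printed (5 * (d : ℝ) * L * B₀) (fun i : ZdIdx d L => (zdGF3 𝔸 L β len i).toGFData) := by
  set cP : ℝ := min (min cF₀ cF) (min c59 cu') with hcPdef
  have hcP : 0 < cP := lt_min (lt_min hcF₀ hcF) (lt_min hc59 hcu')
  have h₁ : cP ≤ cF₀ := (min_le_left _ _).trans (min_le_left _ _)
  have h₂ : cP ≤ cF := (min_le_left _ _).trans (min_le_right _ _)
  have h₃ : cP ≤ c59 := (min_le_right _ _).trans (min_le_left _ _)
  have h₄ : cP ≤ cu' := (min_le_right _ _).trans (min_le_right _ _)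
  exact thm4Printed_zd3_of_HFP hd2 hL hB₀ hB₀' hB hcu hcP (fun i => sockHFP₀_anti h₁ (SHFP₀ i))
    (fun i => sockHFP_anti h₂ (SHFP i)) (fun i => sockH59_anti h₃ (SH59 i)) (fun i => sockP5u_anti h₄ (SP5u i))

end Thm4


/-! ## §4 PROPOSITION 3 (p. 87) as `B8.Prop3Printed` on `zdGF3`, modulo the in-edge b9 in Proposition 3's frame -/

section Prop3

variable {𝔸 : Type*} [CStarAlgebra 𝔸] [Nontrivial 𝔸]

/-- **The in-edge b9 in PROPOSITION 3's FRAME** = Theorem 3.3 of [4] for `G(U₀)`, `H(U₀)` read through (1.57)–(1.58): for a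
unitary-valued background `U₀` and field `W` with (1.40) `U₀, WU₀ ∈ 𝔄_k({Ω_j}, α₀)`, the Landau condition of record (1.38)/(1.42)₁ for
`W`, and a Hermitian exponent field `A′` with `W = e^{iηA′}`, (1.41) `|A′| ≤ α₂(Lʲη)⁻¹` on the sides of the plaquettes touching `Ω_j`
(`j ≤ k`) and `A′ = 0` off them — the FIVE lines of (1.59): `|A′|₍₋₁₎, |∇^η_{U₀}A′|₍₋₂₎, |D^{η*}D^ηA′|₍₋₃₎, |Δ^η_{U₀}A′|₍₋₃₎ ≤ B₀(|J|₍₋₃₎ +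
|B₁|)` and the Hölder line with `B₀(β)`; `J` = the current of (1.57) (`B8Eq155JBound.Jcur`), `|B₁| = sup_{j, c ∈ Λ_j}‖LʲηQ_j(U₀)A′(c)‖`
(`linCovIter`).  Guarded by `α₀, α₂ ≤ cP`.  No (3.35)-clause in the guard (print drops it via Prop. 6, p. 83): the provider composes [4]
Thm 3.3 with Prop. 6. [cite: Balaban1985RegularSpaces, (1.57)–(1.59) p.86, (1.40)–(1.42) p.83; Balaban1985BackgroundPropagators, Thm 3.3 p.398] -/
def SockB9P3 (L : ℕ) (B₀ B₀β cP β : ℝ) (len : Site d → ℝ) (η : ℝ) (k : ℕ) (Ω : ℕ → Set (Site d))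
    (Λs : ℕ → ℕ → Set (Site d)) (Λb : ℕ → ℕ → Set (Site d × Fin d)) : Prop :=
  ∀ α₀ α₂ : ℝ, 0 < α₀ → α₀ ≤ cP → 0 < α₂ → α₂ ≤ cP →
    ∀ (U₀ W : Site d → Fin d → 𝔸ˣ), (∀ x κ, U₀ x κ ∈ unitaryUnits 𝔸) → (∀ x κ, W x κ ∈ unitaryUnits 𝔸) →
    InAk L k η α₀ Ω U₀ → InAk L k η α₀ Ω (mulCfg W U₀) → IsLandau138W L k η (Ω 0) (Λs k) U₀ W →
    ∀ A' : Site d → Fin d → 𝔸, (∀ y τ, IsSelfAdjoint (A' y τ)) →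
    (∀ j, j ≤ k → ∀ (y : Site d) (τ : Fin d), SideTouches (Ω j) y τ →
      W y τ = cfgExp η A' y τ ∧ ‖A' y τ‖ ≤ α₂ * ((L : ℝ) ^ j * η)⁻¹) →
    (∀ (y : Site d) (τ : Fin d), (∀ j, j ≤ k → ¬ SideTouches (Ω j) y τ) → A' y τ = 0) →
    msup L k η (-(1 : ℝ)) (fun j (b : Site d × Fin d) => SideTouches (Ω j) b.1 b.2) (fun b => A' b.1 b.2)
        ≤ B₀ * (bondNorm L k η (-(3 : ℝ)) Ω (fun x μ => Jcur η U₀ A' μ x)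
          + wsup 1 (fun p : {p : ℕ × (Site d × Fin d) // p.1 ≤ k ∧ p.2 ∈ Λb k p.1} =>
              linCovIter L U₀ (iEta η A') p.1.1 p.1.2.1 p.1.2.2)) ∧
      msup L k η (-(2 : ℝ)) (fun j (t : Fin d × Fin d × Site d) => SideTouches (Ω j) t.2.2 t.2.1)
          (fun t => covDerivFwd η U₀ t.1 (fun z => A' z t.2.1) t.2.2)
        ≤ B₀ * (bondNorm L k η (-(3 : ℝ)) Ω (fun x μ => Jcur η U₀ A' μ x)
          + wsup 1 (fun p : {p : ℕ × (Site d × Fin d) // p.1 ≤ k ∧ p.2 ∈ Λb k p.1} =>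
              linCovIter L U₀ (iEta η A') p.1.1 p.1.2.1 p.1.2.2)) ∧
      bondNorm L k η (-(3 : ℝ)) Ω (fun x μ => pdiv η U₀ (plaqCovDeriv η U₀ A') μ x)
        ≤ B₀ * (bondNorm L k η (-(3 : ℝ)) Ω (fun x μ => Jcur η U₀ A' μ x)
          + wsup 1 (fun p : {p : ℕ × (Site d × Fin d) // p.1 ≤ k ∧ p.2 ∈ Λb k p.1} =>
              linCovIter L U₀ (iEta η A') p.1.1 p.1.2.1 p.1.2.2)) ∧
      bondNorm L k η (-(3 : ℝ)) Ω (fun x μ => covLap η U₀ (fun z => A' z μ) x)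
        ≤ B₀ * (bondNorm L k η (-(3 : ℝ)) Ω (fun x μ => Jcur η U₀ A' μ x)
          + wsup 1 (fun p : {p : ℕ × (Site d × Fin d) // p.1 ≤ k ∧ p.2 ∈ Λb k p.1} =>
              linCovIter L U₀ (iEta η A') p.1.1 p.1.2.1 p.1.2.2)) ∧
      msup L k η (-(2 + β)) (fun j (q : Fin d × Fin d × (Site d × Site d)) => q.2.2 ∈ AdmPair η len ∧ q.2.2.1 ∈ Ω j)
          (fun q => hquot η β len U₀ (covDerivFwd η U₀ q.1 (fun z => A' z q.2.1)) q.2.2)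
        ≤ B₀β * (bondNorm L k η (-(3 : ℝ)) Ω (fun x μ => Jcur η U₀ A' μ x)
          + wsup 1 (fun p : {p : ℕ × (Site d × Fin d) // p.1 ≤ k ∧ p.2 ∈ Λb k p.1} =>
              linCovIter L U₀ (iEta η A') p.1.1 p.1.2.1 p.1.2.2))

omit [Nontrivial 𝔸] in
/-- `SockB9P3` is antitone in the threshold `cP`. [cite: Balaban1985RegularSpaces, (1.59) p.86] -/
theorem sockB9P3_anti {L : ℕ} {B₀ B₀β cP cP' β : ℝ} {len : Site d → ℝ} (h : cP' ≤ cP) {η : ℝ} {k : ℕ} {Ω : ℕ → Set (Site d)}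
    {Λs : ℕ → ℕ → Set (Site d)} {Λb : ℕ → ℕ → Set (Site d × Fin d)} (S : SockB9P3 (𝔸 := 𝔸) L B₀ B₀β cP β len η k Ω Λs Λb) :
    SockB9P3 (𝔸 := 𝔸) L B₀ B₀β cP' β len η k Ω Λs Λb :=
  fun α₀ α₂ hα₀ hα₀c hα₂ hα₂c => S α₀ α₂ hα₀ (hα₀c.trans h) hα₂ (hα₂c.trans h)

end Prop3

section Windows

/-- The [3]-Prop.-4 window `e^{x}(1 + y) ≤ 2` from `0 ≤ x ≤ 1/10`, `0 ≤ y ≤ 1/2` (as in `B8Prop3KLevel`). [folklore] -/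
private theorem exp_window {x y : ℝ} (hx0 : 0 ≤ x) (hx : x ≤ 1 / 10) (hy0 : 0 ≤ y) (hy : y ≤ 1 / 2) :
    Real.exp x * (1 + y) ≤ 2 := by
  have h := Real.abs_exp_sub_one_le (x := x) (by rw [abs_of_nonneg hx0]; linarith)
  rw [abs_of_nonneg hx0] at h
  have h2 : Real.exp x ≤ 1 + 2 * x := by linarith [(abs_le.mp h).2]
  have h3 : Real.exp x ≤ 6 / 5 := by linarith
  calc Real.exp x * (1 + y) ≤ 6 / 5 * (1 + 1 / 2) := by
        gcongr
    _ ≤ 2 := by norm_num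

/-- **Proposition 3's windows from ONE threshold** `c(d, L, B₀) = min{1/(24C₀), c₂′/16, 1/(32000(d+1)²(d+4)), 1/(2097152(d+1)²), c₃/2,
1/(80d), 1/(72d(B₀+1))}` (the threshold of `B8Prop3KLevel.prop3_kLevel`): for `0 < α₀ ≤ c`, `0 ≤ α₂ ≤ c` the eight windows of
`B8Prop3KLevel.prop3_norms_kLevel` hold and the (1.56)-constant is majorised by `2097152(d+1)²`.
[cite: Balaban1985RegularSpaces, Prop. 3 p.87 («α₀, α₁, α₂ bounded by a constant depending on d and L only»)] -/
theorem prop3_windows (hd2 : 2 ≤ d) {L : ℕ} (hL : 2 ≤ L) {B₀ : ℝ} (hB₀ : 0 ≤ B₀) :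
    ∃ c : ℝ, 0 < c ∧ ∀ α₀ α₂ : ℝ, 0 < α₀ → α₀ ≤ c → 0 ≤ α₂ → α₂ ≤ c →
      C0 d * α₀ ≤ 1 / 3 ∧ 4 * α₀ ≤ c2' d L ∧ 16 * α₂ ≤ 1 ∧ 5 * α₂ * ((d : ℝ) - 1) ≤ 4 ∧
      Real.exp (4 * (800 * ((d : ℝ) + 1) ^ 2 * ((d : ℝ) + 4)) * α₀) * (1 + 8 * (131072 * ((d : ℝ) + 1) ^ 2) * α₂) ≤ 2 ∧
      2 * α₂ ≤ c3 d L ∧ 36 * d * B₀ * α₂ ≤ 1 / 2 ∧ 50 * d * α₂ ≤ 1 ∧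
      8 * (131072 * ((d : ℝ) + 1) ^ 2) * Real.exp (4 * (800 * ((d : ℝ) + 1) ^ 2 * ((d : ℝ) + 4)) * α₀)
        ≤ 2097152 * ((d : ℝ) + 1) ^ 2 := by
  have hd : 1 ≤ d := le_trans (by norm_num) hd2
  have hd' : (1 : ℝ) ≤ d := by exact_mod_cast hd
  have hd0 : (0 : ℝ) < d := by linarith
  have hL1 : 1 ≤ L := le_trans (by norm_num) hL
  have hC0 := B7Prop2Explicit.C0_pos d
  have hc2 : 0 < c2' d L := B7Prop2Explicit.c2'_pos d L hL1
  have hc3 : 0 < c3 d L := B7Prop3Flat.c3_pos d hL1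
  refine ⟨min (1 / (24 * C0 d)) (min (c2' d L / 16) (min (1 / (32000 * ((d : ℝ) + 1) ^ 2 * ((d : ℝ) + 4)))
    (min (1 / (2097152 * ((d : ℝ) + 1) ^ 2)) (min (c3 d L / 2) (min (1 / (80 * (d : ℝ)))
    (1 / (72 * (d : ℝ) * (B₀ + 1)))))))), ?_, ?_⟩
  · refine lt_min (by positivity) (lt_min (by positivity) (lt_min (by positivity) (lt_min (by positivity)
      (lt_min (by positivity) (lt_min (by positivity) (by positivity))))))
  intro α₀ α₂ hα₀ hα₀c hα₂ hα₂c
  simp only [le_min_iff] at hα₀c hα₂c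
  obtain ⟨h24₀, h16₀, h32₀, -, -, -, -⟩ := hα₀c
  obtain ⟨-, -, -, h21₂, hc3₂, h80₂, h72₂⟩ := hα₂c
  have hα3 : C0 d * α₀ ≤ 1 / 3 := by
    have e : C0 d * (1 / (24 * C0 d)) = 1 / 24 := by field_simp
    have := (mul_le_mul_of_nonneg_left h24₀ hC0.le).trans_eq e
    linarith
  have hα4 : 4 * α₀ ≤ c2' d L := by linarith
  have h80 : α₂ ≤ 1 / 80 := by
    have : (1 : ℝ) / (80 * d) ≤ 1 / 80 := by
      rw [div_le_div_iff₀ (by positivity) (by norm_num)]; nlinarith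
    exact h80₂.trans this
  have h16 : 16 * α₂ ≤ 1 := by linarith
  have hdα : (d : ℝ) * α₂ ≤ 1 / 80 := by
    have := mul_le_mul_of_nonneg_left h80₂ hd0.le
    have e : (d : ℝ) * (1 / (80 * d)) = 1 / 80 := by field_simp
    linarith [this.trans_eq e]
  have h50 : 50 * d * α₂ ≤ 1 := by nlinarith
  have hd5 : 5 * α₂ * ((d : ℝ) - 1) ≤ 4 := by nlinarith
  have hside : 36 * d * B₀ * α₂ ≤ 1 / 2 := by
    have h1 : 36 * d * B₀ * α₂ ≤ 36 * d * B₀ * (1 / (72 * (d : ℝ) * (B₀ + 1))) :=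
      mul_le_mul_of_nonneg_left h72₂ (by positivity)
    have e : 36 * d * B₀ * (1 / (72 * (d : ℝ) * (B₀ + 1))) = B₀ / (2 * (B₀ + 1)) := by
      field_simp
      ring
    have h2 : B₀ / (2 * (B₀ + 1)) ≤ 1 / 2 := by
      rw [div_le_div_iff₀ (by positivity) (by norm_num)]; nlinarith
    linarith [h1.trans_eq e]
  have hx0 : 0 ≤ 4 * (800 * ((d : ℝ) + 1) ^ 2 * ((d : ℝ) + 4)) * α₀ := by positivity
  have hx : 4 * (800 * ((d : ℝ) + 1) ^ 2 * ((d : ℝ) + 4)) * α₀ ≤ 1 / 10 := by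
    have h := mul_le_mul_of_nonneg_left h32₀ (by positivity : (0 : ℝ) ≤ 3200 * (((d : ℝ) + 1) ^ 2 * ((d : ℝ) + 4)))
    have e : (3200 * (((d : ℝ) + 1) ^ 2 * ((d : ℝ) + 4))) * (1 / (32000 * ((d : ℝ) + 1) ^ 2 * ((d : ℝ) + 4)))
        = 1 / 10 := by
      field_simp; ring
    have e' : 4 * (800 * ((d : ℝ) + 1) ^ 2 * ((d : ℝ) + 4)) * α₀
        = (3200 * (((d : ℝ) + 1) ^ 2 * ((d : ℝ) + 4))) * α₀ := by ring
    rw [e']; exact h.trans_eq e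
  have hy0 : 0 ≤ 8 * (131072 * ((d : ℝ) + 1) ^ 2) * α₂ := by positivity
  have hy : 8 * (131072 * ((d : ℝ) + 1) ^ 2) * α₂ ≤ 1 / 2 := by
    have h := mul_le_mul_of_nonneg_left h21₂ (by positivity : (0 : ℝ) ≤ 1048576 * ((d : ℝ) + 1) ^ 2)
    have e : (1048576 * ((d : ℝ) + 1) ^ 2) * (1 / (2097152 * ((d : ℝ) + 1) ^ 2)) = 1 / 2 := by
      field_simp; ring
    have e' : 8 * (131072 * ((d : ℝ) + 1) ^ 2) * α₂ = (1048576 * ((d : ℝ) + 1) ^ 2) * α₂ := by ring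
    rw [e']; exact h.trans_eq e
  have hsmall : Real.exp (4 * (800 * ((d : ℝ) + 1) ^ 2 * ((d : ℝ) + 4)) * α₀)
      * (1 + 8 * (131072 * ((d : ℝ) + 1) ^ 2) * α₂) ≤ 2 := exp_window hx0 hx hy0 hy
  have hc₃ : 2 * α₂ ≤ c3 d L := by linarith
  have hC : 8 * (131072 * ((d : ℝ) + 1) ^ 2) * Real.exp (4 * (800 * ((d : ℝ) + 1) ^ 2 * ((d : ℝ) + 4)) * α₀)
      ≤ 2097152 * ((d : ℝ) + 1) ^ 2 := by
    set E := Real.exp (4 * (800 * ((d : ℝ) + 1) ^ 2 * ((d : ℝ) + 4)) * α₀) with hE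
    have hEx : E ≤ 6 / 5 := by
      have h := Real.abs_exp_sub_one_le (x := 4 * (800 * ((d : ℝ) + 1) ^ 2 * ((d : ℝ) + 4)) * α₀)
        (by rw [abs_of_nonneg hx0]; linarith)
      rw [abs_of_nonneg hx0] at h
      linarith [(abs_le.mp h).2]
    have hK : 0 ≤ 8 * (131072 * ((d : ℝ) + 1) ^ 2) := by positivity
    calc 8 * (131072 * ((d : ℝ) + 1) ^ 2) * E ≤ 8 * (131072 * ((d : ℝ) + 1) ^ 2) * 2 :=
          mul_le_mul_of_nonneg_left (by linarith) hK
      _ = 2097152 * ((d : ℝ) + 1) ^ 2 := by ring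
  exact ⟨hα3, hα4, h16, hd5, hsmall, hc₃, hside, h50, hC⟩

/-- For `d ≥ 2`, a bond touching `S` is a side of a plaquette touching `S`. [cite: Balaban1985RegularSpaces, p.77 (convention before (1.5))] -/
private theorem sideTouches_of_bondTouches' (hd2 : 2 ≤ d) {S : Set (Site d)} {y : Site d} {τ : Fin d}
    (hb : BondTouches S y τ) : SideTouches S y τ := by
  haveI : Nontrivial (Fin d) := Fin.nontrivial_iff_two_le.mpr hd2
  obtain ⟨κ, hκ⟩ := exists_ne τ
  exact B8Eq140Level.sideTouches_of_bondTouches hκ hb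

end Windows

section Prop3Instance

variable {𝔸 : Type} [CStarAlgebra 𝔸] [Nontrivial 𝔸]

/-- **`B8.Prop3Printed` ON `zdGF3`** (Proposition 3, p. 87: «(1.40)–(1.42) with α₀, α₁, α₂ bounded by a constant depending on d and L only, and
(1.61) ⇒ (1.36)–(1.39) with B₁ = 5dLB₀, B₂(β₀) = 5dLB₀(β₀)»), for `d, L ≥ 2`, the leaf's `inp : B8.B9Inputs` (`B₀ = inp.B₀`), any `B₀β ≥ 0`,
any (1.61)-constant `C₂ ≥ 2097152(d+1)²` (n05-b's `C₂(d)`), any Hölder data `β, len`, and a provider threshold `cP > 0` — MODULO, per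
member, the Prop.-3-frame b9 socket `SockB9P3` ([4] Thm 3.3).  PROOF = n05-b's `B8Prop3KLevel.prop3_norms_kLevel` (the four members of
(1.62) in norm form) + `prop3_fifth_kLevel` (the Hölder member) at `A := mlogCfg k η Ω U₁` — self-adjoint, `= (1/iη) log U₁` with the
(1.41) bound on the `E j`, `0` off them —, (1.40)₁ transported from `U₁U₀` to `e^{iηA}U₀` by locality (`inAk_congr_of_sideTouches`), the
gradient datum `g := |∇^η_{U₀}A|₍₋₂₎` (bounded family, as in n11-b's `thm2_norms_gaugeFixed_kLevel`), (1.42) = the member's `C137`, the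
(1.59) lines from the socket (Landau clause transported by `isLandau138W_congr`), the windows from `prop3_windows`; the pointwise (1.36)₁
member by n11-b's `thm2_pointwise_A`. [cite: Balaban1985RegularSpaces, Prop. 3 p.87, (1.40)–(1.42) p.83, (1.59)–(1.62) pp.86–87, (1.36)–(1.39) p.82] -/
theorem prop3Printed_zd3 (hd2 : 2 ≤ d) {L : ℕ} (hL : 2 ≤ L) (inp : B8.B9Inputs) {B₀β C₂ cP : ℝ} (hB₀β : 0 ≤ B₀β)
    (hC₂ : 2097152 * ((d : ℝ) + 1) ^ 2 ≤ C₂) (hcP : 0 < cP) (β : ℝ) (len : Site d → ℝ)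
    (SB9 : ∀ i : ZdIdx d L, SockB9P3 (𝔸 := 𝔸) L inp.B₀ B₀β cP β len i.η i.k i.Ω i.Λs i.Λb) :
    B8.Prop3Printed d (L : ℝ) C₂ inp B₀β (fun i : ZdIdx d L => (zdGF3 𝔸 L β len i).toGFData2) := by
  have hL1 : 1 ≤ L := le_trans (by norm_num) hL
  have hLr : (1 : ℝ) ≤ L := by exact_mod_cast hL1
  have hB₀ : 0 ≤ inp.B₀ := inp.B₀_pos.le
  obtain ⟨cN, hcN, hwin⟩ := prop3_windows hd2 hL hB₀
  refine ⟨min cP cN, lt_min hcP hcN, ?_⟩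
  intro i α₀ α₁ α₂ hα₀ hα₀c hα₁ _ hα₂ hα₂c h61 U₀ P hInA _ hPair h162 hLan h137
  have hα₀P : α₀ ≤ cP := hα₀c.trans (min_le_left _ _)
  have hα₂P : α₂ ≤ cP := hα₂c.trans (min_le_left _ _)
  obtain ⟨hα3, hα4, h16, hd5, hsmall, hc₃, hside, h50, hC⟩ :=
    hwin α₀ α₂ hα₀ (hα₀c.trans (min_le_right _ _)) hα₂.le (hα₂c.trans (min_le_right _ _))
  have hC₂' : 8 * (131072 * ((d : ℝ) + 1) ^ 2) * Real.exp (4 * (800 * ((d : ℝ) + 1) ^ 2 * ((d : ℝ) + 4)) * α₀) ≤ C₂ :=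
    hC.trans hC₂
  -- the data
  set W : Site d → Fin d → 𝔸ˣ := P.2.1 with hW_def
  have hWu : ∀ x κ, W x κ ∈ unitaryUnits 𝔸 := P.2.2
  have hU₀ : ∀ x κ, U₀.1 x κ ∈ unitaryUnits 𝔸 := U₀.2
  set A : Site d → Fin d → 𝔸 := mlogCfg i.k i.η i.Ω W with hA_def
  -- (1.41) and self-adjointness of the canonical exponent; `W = e^{iηA}` on the `E j`
  have h41 : ∀ j, j ≤ i.k → ∀ (y : Site d) (τ : Fin d), SideTouches (i.Ω j) y τ →
      W y τ = cfgExp i.η A y τ ∧ ‖A y τ‖ ≤ α₂ * ((L : ℝ) ^ j * i.η)⁻¹ := by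
    intro j hj y τ hs
    obtain ⟨hexp, -, hbd⟩ := h162 j hj (y, τ) hs
    have hexp' : W y τ = cfgExp i.η (logCfg i.η W) y τ := hexp
    have hbd' : ‖logCfg i.η W y τ‖ ≤ 1 * α₂ * ((L : ℝ) ^ j * i.η)⁻¹ := hbd
    have hAy : A y τ = logCfg i.η W y τ := mlogCfg_of_sideTouches i.η W hj hs
    refine ⟨?_, ?_⟩
    · rw [hexp']
      exact cfgExp_congr_at i.η hAy.symm
    · rw [hAy]
      simpa only [one_mul] using hbd'
  have hAsa : ∀ y τ, IsSelfAdjoint (A y τ) := by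
    intro y τ
    by_cases hmem : ∃ j, j ≤ i.k ∧ SideTouches (i.Ω j) y τ
    · obtain ⟨j, hj, hs⟩ := hmem
      rw [hA_def, mlogCfg_of_sideTouches i.η W hj hs]
      exact (h162 j hj (y, τ) hs).2.1
    · rw [hA_def, mlogCfg_of_not i.η W fun j hj hs => hmem ⟨j, hj, hs⟩]
      exact IsSelfAdjoint.zero 𝔸
  have hA0 : ∀ (y : Site d) (τ : Fin d), (∀ j, j ≤ i.k → ¬ SideTouches (i.Ω j) y τ) → A y τ = 0 :=
    fun y τ h => mlogCfg_of_not i.η W h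
  -- (1.40)₁ for `e^{iηA}U₀` by locality; the Landau clause for `e^{iηA}` by locality
  have h40₁ : InAk L i.k i.η α₀ i.Ω (mulCfg (expCfg (iEta i.η A)) U₀.1) := by
    refine (inAk_congr_of_sideTouches L i.k i.η α₀ (V := mulCfg W U₀.1) fun j hj y τ hs => ?_).1 hPair
    show W y τ * U₀.1 y τ = expCfg (iEta i.η A) y τ * U₀.1 y τ
    rw [(h41 j hj y τ hs).1, expCfg_iEta_eq_cfgExp]
  -- the global bound and the gradient datum (bounded family)
  have hAglob : ∀ y τ, ‖A y τ‖ ≤ α₂ * i.η⁻¹ := by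
    intro y τ
    by_cases hmem : ∃ j, j ≤ i.k ∧ SideTouches (i.Ω j) y τ
    · obtain ⟨j, hj, hs⟩ := hmem
      have hLj : (1 : ℝ) ≤ (L : ℝ) ^ j := one_le_pow₀ hLr
      have hη0 : 0 < i.η := i.hη
      calc ‖A y τ‖ ≤ α₂ * ((L : ℝ) ^ j * i.η)⁻¹ := (h41 j hj y τ hs).2
        _ = α₂ * i.η⁻¹ * ((L : ℝ) ^ j)⁻¹ := by rw [mul_inv]; ring
        _ ≤ α₂ * i.η⁻¹ * 1 := by
            apply mul_le_mul_of_nonneg_left (inv_le_one_of_one_le₀ hLj) (by positivity)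
        _ = α₂ * i.η⁻¹ := mul_one _
    · rw [hA0 y τ fun j hj hs => hmem ⟨j, hj, hs⟩, norm_zero]
      have hη0 : 0 < i.η := i.hη
      positivity
  have hU₀1 : ∀ x κ, U₀.1 x κ ∈ U1 𝔸 := fun x κ => unitaryUnits_le_U1 (hU₀ x κ)
  have hgrad : ∀ (y : Site d) (κ τ : Fin d), ‖covDerivFwd i.η U₀.1 κ (fun z => A z τ) y‖ ≤ 2 * α₂ * i.η⁻¹ * i.η⁻¹ := by
    intro y κ τ
    have hη0 : 0 < i.η := i.hη
    unfold covDerivFwd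
    rw [norm_smul, norm_inv, Real.norm_eq_abs, abs_of_pos hη0]
    have h1 : ‖B7Eq78Linearization.conjR (U₀.1 y κ) (A (y + e κ) τ) - A y τ‖ ≤ α₂ * i.η⁻¹ + α₂ * i.η⁻¹ := by
      calc ‖B7Eq78Linearization.conjR (U₀.1 y κ) (A (y + e κ) τ) - A y τ‖
          ≤ ‖B7Eq78Linearization.conjR (U₀.1 y κ) (A (y + e κ) τ)‖ + ‖A y τ‖ := norm_sub_le _ _
        _ ≤ α₂ * i.η⁻¹ + α₂ * i.η⁻¹ := by
            rw [B8Ineq132.norm_conjR (hU₀1 y κ)]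
            exact add_le_add (hAglob _ _) (hAglob _ _)
    calc i.η⁻¹ * ‖B7Eq78Linearization.conjR (U₀.1 y κ) (A (y + e κ) τ) - A y τ‖ ≤ i.η⁻¹ * (α₂ * i.η⁻¹ + α₂ * i.η⁻¹) :=
        mul_le_mul_of_nonneg_left h1 (by positivity)
      _ = 2 * α₂ * i.η⁻¹ * i.η⁻¹ := by ring
  have hBg : Bdd L i.k i.η (-(2 : ℝ)) (fun j (t : Fin d × Fin d × Site d) => SideTouches (i.Ω j) t.2.2 t.2.1)
      (fun t => covDerivFwd i.η U₀.1 t.1 (fun z => A z t.2.1) t.2.2) := by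
    have e2 : (-(2 : ℝ)) = -((2 : ℕ) : ℝ) := by norm_num
    rw [e2]
    refine B8ScaledSupNorm.bdd_of_forall (c := 2 * α₂ * ((L : ℝ) ^ i.k) ^ 2) fun j hj t _ => ?_
    rw [B8ScaledSupNorm.weight_neg_natCast L i.η 2 j]
    have hLjk : (L : ℝ) ^ j ≤ (L : ℝ) ^ i.k := pow_le_pow_right₀ hLr hj
    have hLj0 : (0 : ℝ) ≤ (L : ℝ) ^ j := by positivity
    have hη0 : 0 < i.η := i.hη
    calc ((L : ℝ) ^ j * i.η) ^ 2 * ‖covDerivFwd i.η U₀.1 t.1 (fun z => A z t.2.1) t.2.2‖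
        ≤ ((L : ℝ) ^ j * i.η) ^ 2 * (2 * α₂ * i.η⁻¹ * i.η⁻¹) := mul_le_mul_of_nonneg_left (hgrad _ _ _) (by positivity)
      _ = 2 * α₂ * ((L : ℝ) ^ j) ^ 2 := by field_simp
      _ ≤ 2 * α₂ * ((L : ℝ) ^ i.k) ^ 2 := by gcongr
  set g : ℝ := msup L i.k i.η (-(2 : ℝ)) (fun j (t : Fin d × Fin d × Site d) => SideTouches (i.Ω j) t.2.2 t.2.1)
      (fun t => covDerivFwd i.η U₀.1 t.1 (fun z => A z t.2.1) t.2.2) with hg_def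
  have hg0 : 0 ≤ g := B8ScaledSupNorm.msup_nonneg L i.k i.hη.le _ _ _
  have hg : ∀ j, j ≤ i.k → ∀ (y : Site d) (κ τ : Fin d), SideTouches (i.Ω j) y τ →
      ((L : ℝ) ^ j * i.η) ^ 2 * ‖covDerivFwd i.η U₀.1 κ (fun z => A z τ) y‖ ≤ g := by
    intro j hj y κ τ hs
    have h := B8ScaledSupNorm.weight_mul_norm_le_msup hBg hj (i := (κ, τ, y)) hs
    have hw : weight L i.η (-(2 : ℝ)) j = ((L : ℝ) ^ j * i.η) ^ 2 := by
      have e2 : (-(2 : ℝ)) = -((2 : ℕ) : ℝ) := by norm_num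
      rw [e2, B8ScaledSupNorm.weight_neg_natCast L i.η 2 j]
    rw [hw] at h
    exact h
  -- the Landau clause for `e^{iηA}` and the in-edge (1.59), five lines, from the socket
  have hLanA : IsLandau138W L i.k i.η (i.Ω 0) (i.Λs i.k) U₀.1 W := hLan
  obtain ⟨h59a, h59g, h59j, h59l, h59h⟩ := SB9 i α₀ α₂ hα₀ hα₀P hα₂ hα₂P U₀.1 W hU₀ hWu hInA hPair hLanA A hAsa h41 hA0
  -- (1.42) = the member's (1.37) clause, on the classified constraint bonds of the top truncation
  have hbox : ∀ j, j ≤ i.k → ∀ c ∈ i.Λb i.k j, ∀ x, InBox (loK L j c.1) (bondHiK L j c.1 c.2) x → x ∈ i.Ω j :=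
    fun j hj c hc x hx => i.hbox i.k le_rfl j hj c hc x hx
  have h42 : ∀ j, j ≤ i.k → ∀ c ∈ i.Λb i.k j, ‖logCovIter L U₀.1 (iEta i.η A) j c.1 c.2‖ < 2 * d * L * α₁ := h137
  have h41' : ∀ j, j ≤ i.k → ∀ (y : Site d) (τ : Fin d), SideTouches (i.Ω j) y τ → ‖A y τ‖ ≤ α₂ * ((L : ℝ) ^ j * i.η)⁻¹ :=
    fun j hj y τ hs => (h41 j hj y τ hs).2
  -- PROPOSITION 3 at `k` levels (n05-b), all four members, and the Hölder member
  obtain ⟨ha, hg', hj, hl⟩ := B8Prop3KLevel.prop3_norms_kLevel hd2 i.hη hL hU₀ hAsa hα₀ hα₁.le hα₂.le hg0 hα3 hα4 h16 hd5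
    hsmall hc₃ hB₀ hside h50 hC₂' h61 hbox hInA h40₁ h41' hg h42 h59a h59g h59j h59l
  have hh := B8Prop3KLevel.prop3_fifth_kLevel hd2 i.hη hL hU₀ hAsa hα₀ hα₁.le hα₂.le hg0 hα3 hα4 h16 hd5 hsmall hc₃ hB₀ hB₀β
    hside h50 hC₂' h61 hbox hInA h40₁ h41' hg h42 h59g h59h
  refine ⟨⟨fun j hj b hb => ?_, hg', hh⟩, hj, hl⟩
  -- (1.36)₁ pointwise on the `E j`, read on the logarithm
  obtain ⟨hexp, hsa, -⟩ := h162 j hj b hb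
  refine ⟨hexp, hsa, ?_⟩
  have hpt := B8Thm2GaugeFixedKLevel.thm2_pointwise_A i.hη hL1 h41' ha hj (y := b.1) (τ := b.2) hb
  rw [← mlogCfg_of_sideTouches i.η W hj hb]
  exact hpt

end Prop3Instance

#print axioms thm4Printed_zd3
#print axioms thm4Printed_zd3_of_HFP
#print axioms prop3Printed_zd3

end Literature.MathematicalPhysics.QuantumFieldTheory.Balaban1983to89.B8LeafModelZd3

end
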